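import Literature.Analysis.FluidPDE.HardSphereDynamicsProofs
import Literature.Analysis.FluidPDE.HardSphereRegularGeometry
import Literature.Analysis.FluidPDE.HardSpherePhaseSpaceProofs
import Literature.Analysis.FluidPDE.HardSphereFreeStretch

/-!
# Anchored covering, prelim 1: kinematics of one hard sphere on the flat torus

Prelim file of the registered stub `stub_anchoredCovering` (line `true-anchored-infection` of the
crux `InfluenceLocality`, stmt-AtomisticToContinuum-13916). Elementary deterministic kinematics
of a single particle `j` along a hard-sphere trajectory `γ` on `T^d`
(`IsHardSphereTrajectory (Torus.geometry d) ε N γ`), for the minimal-image distance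
`Torus.euclidDist`:

* `torusDist_triangle`, `torusDist_translate_self_le` — triangle inequality and the displacement
  of a translate;
* `exists_right_flight` — immediately to the right of every time the particle flies freely, so
  it moves by at most `(t - x) ‖v_j(x)‖`;
* `disp_le_of_guarded_speed` — **guarded displacement bound**: if the speed of `j` is `≤ V` at
  every time `t ∈ [a, b)` at which `dist(x_j(t), x_j(a)) ≤ V (t - a)` already holds, then
  `dist(x_j(t), x_j(a)) ≤ V (t - a)` on `[a, b]` (continuous induction over the locally finitely
  many collisions, positions being continuous);
* `sub_le_dist_of_capped_in_halo` — **halo lower bound**: a particle whose speed is `≤ V`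
  whenever it is within `ρ'` of a point `x₀`, and which starts at distance `≥ ρ` (`ρ < ρ'`),
  is at distance `≥ ρ - V t` at time `t`;
* `anchoredCovering_kinematics` — the two bounds, recorded as the registered statement of this
  prelim file.
-/

namespace Summit.AtomisticToContinuum.HydrodynamicLimit.Theorems.TrueAnchoredInfection

open Set Filter Topology Function
open Literature.Analysis Literature.Analysis.FluidPDE

noncomputable section

variable {d : Type*} [Fintype d]

/-! ## The minimal-image distance -/

/-- Triangle inequality for the minimal-image distance on `T^d`. -/
theorem torusDist_triangle (x y z : UnitAddTorus d) :
    Torus.euclidDist x z ≤ Torus.euclidDist x y + Torus.euclidDist y z := by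
  have h := Torus.euclidDist_proj_le_norm_sub_holds (d := d)
    (Torus.reprSym (x - y) + Torus.reprSym (y - z)) 0
  rw [FunctionSpaces.Torus.proj_add, Torus.proj_reprSym, Torus.proj_reprSym,
    FunctionSpaces.Torus.proj_zero, sub_zero, show x - y + (y - z) = x - z - 0 by abel] at h
  have h0 : Torus.euclidDist (x - z - 0) 0 = Torus.euclidDist x z := by
    rw [Torus.euclidDist_eq, Torus.euclidDist_eq, sub_zero, sub_zero]
  rw [h0] at h
  exact h.trans (norm_add_le _ _)

/-- A translate `x + proj a` is within `‖a‖` of `x`. -/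
theorem torusDist_translate_self_le (x : UnitAddTorus d) (a : EuclideanSpace ℝ d) :
    Torus.euclidDist (x + FunctionSpaces.Torus.proj a) x ≤ ‖a‖ := by
  have h := Torus.euclidDist_proj_le_norm_sub_holds (d := d) (Torus.reprSym x + a) (Torus.reprSym x)
  rwa [FunctionSpaces.Torus.proj_add, Torus.proj_reprSym, add_sub_cancel_left] at h

/-- The minimal-image distance to a fixed point is continuous along a continuous curve. -/
theorem continuous_torusDist_comp {P : ℝ → UnitAddTorus d} (hP : Continuous P) (x₀ : UnitAddTorus d) :
    Continuous fun t => Torus.euclidDist (P t) x₀ := by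
  simpa only [Function.comp_def] using
    Torus.continuous_euclidDist.comp (hP.prodMk continuous_const)

/-! ## One particle along a hard-sphere trajectory -/

variable {ε : ℝ} {N : ℕ} {γ : ℝ → Config N d (UnitAddTorus d)}

/-- Immediately to the right of any time `x` particle `j` flies freely: it moves by at most
`(t - x) ‖v_j(x)‖` and keeps its velocity. -/
theorem exists_right_flight (h : IsHardSphereTrajectory (Torus.geometry d) ε N γ) (x : ℝ)
    (j : Fin N) :
    ∃ u > x, ∀ t ∈ Ico x u, Torus.euclidDist (γ t j).1 (γ x j).1 ≤ (t - x) * ‖(γ x j).2‖ ∧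
      (γ t j).2 = (γ x j).2 := by
  obtain ⟨u, hxu, hfree⟩ := h.exists_Ioo_right_free x
  refine ⟨u, hxu, fun t ht => ?_⟩
  have hff : γ t = freeFlight (Torus.geometry d) (t - x) (γ x) :=
    h.eq_freeFlight_of_Ioo_free hfree ht
  rw [hff, freeFlight_apply, Torus.geometry_translate]
  refine ⟨?_, rfl⟩
  calc _ ≤ ‖(t - x) • (γ x j).2‖ := torusDist_translate_self_le _ _
    _ = (t - x) * ‖(γ x j).2‖ := by rw [norm_smul, Real.norm_of_nonneg (sub_nonneg.2 ht.1)]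

/-- **Guarded displacement bound.** If at every time `t ∈ [a, b)` at which the displacement
bound `dist(x_j(t), x_j(a)) ≤ V (t - a)` holds the speed of `j` is at most `V`, then the
displacement bound holds on all of `[a, b]` (continuous induction: positions are continuous and
between collisions the motion is free flight). -/
theorem disp_le_of_guarded_speed (h : IsHardSphereTrajectory (Torus.geometry d) ε N γ) (j : Fin N)
    {a b V : ℝ}
    (H : ∀ t ∈ Ico a b, Torus.euclidDist (γ t j).1 (γ a j).1 ≤ V * (t - a) → ‖(γ t j).2‖ ≤ V) :
    ∀ t ∈ Icc a b, Torus.euclidDist (γ t j).1 (γ a j).1 ≤ V * (t - a) := by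
  set P : ℝ → UnitAddTorus d := fun t => (γ t j).1 with hP
  have hPc : Continuous P := h.pos_continuous j
  set S : Set ℝ := {t | Torus.euclidDist (P t) (P a) ≤ V * (t - a)} with hS
  have hSc : IsClosed S :=
    isClosed_le (continuous_torusDist_comp hPc (P a)) (by fun_prop)
  have hmem : a ∈ S := by simp [hS]
  have key : Icc a b ⊆ S := by
    refine (hSc.inter isClosed_Icc).Icc_subset_of_forall_mem_nhdsWithin hmem ?_
    rintro x ⟨hxS, hx⟩
    obtain ⟨u, hxu, hstep⟩ := exists_right_flight h x j
    have hV : ‖(γ x j).2‖ ≤ V := H x hx hxS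
    refine mem_of_superset (Ioo_mem_nhdsGT hxu) fun t ht => ?_
    show Torus.euclidDist (P t) (P a) ≤ V * (t - a)
    have hxS' : Torus.euclidDist (P x) (P a) ≤ V * (x - a) := hxS
    have htx : 0 ≤ t - x := sub_nonneg.2 ht.1.le
    calc Torus.euclidDist (P t) (P a) ≤ Torus.euclidDist (P t) (P x) + Torus.euclidDist (P x) (P a) :=
          torusDist_triangle _ _ _
      _ ≤ (t - x) * ‖(γ x j).2‖ + V * (x - a) := add_le_add (hstep t ⟨ht.1.le, ht.2⟩).1 hxS'
      _ ≤ (t - x) * V + V * (x - a) := by gcongr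
      _ = V * (t - a) := by ring
  exact fun t ht => key ht

/-- **Halo lower bound.** Let `x₀` be a point and `ρ < ρ'`, `0 ≤ V`. If on `[0, L]` the speed of
`j` is at most `V` whenever `j` is within `ρ'` of `x₀`, and `j` starts at distance `≥ ρ` from
`x₀`, then at every time `t ∈ [0, L]` it is at distance `≥ ρ - V t` (continuous induction: near
a time at which `j` is in the halo it flies at speed `≤ V`; near a time at which it is not, the
strict bound persists by continuity). -/
theorem sub_le_dist_of_capped_in_halo (h : IsHardSphereTrajectory (Torus.geometry d) ε N γ)
    (j : Fin N) (x₀ : UnitAddTorus d) {L V ρ ρ' : ℝ} (hV : 0 ≤ V) (hρ : ρ < ρ')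
    (hcap : ∀ t ∈ Icc 0 L, Torus.euclidDist (γ t j).1 x₀ < ρ' → ‖(γ t j).2‖ ≤ V)
    (h0 : ρ ≤ Torus.euclidDist (γ 0 j).1 x₀) :
    ∀ t ∈ Icc 0 L, ρ - V * t ≤ Torus.euclidDist (γ t j).1 x₀ := by
  set P : ℝ → UnitAddTorus d := fun t => (γ t j).1 with hP
  have hPc : Continuous P := h.pos_continuous j
  have hgc : Continuous fun t => Torus.euclidDist (P t) x₀ := continuous_torusDist_comp hPc x₀
  set S : Set ℝ := {t | ρ - V * t ≤ Torus.euclidDist (P t) x₀} with hS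
  have hSc : IsClosed S := isClosed_le (by fun_prop) hgc
  have hmem : (0 : ℝ) ∈ S := by simpa [hS] using h0
  have key : Icc 0 L ⊆ S := by
    refine (hSc.inter isClosed_Icc).Icc_subset_of_forall_mem_nhdsWithin hmem ?_
    rintro x ⟨hxS, hx⟩
    have hxS' : ρ - V * x ≤ Torus.euclidDist (P x) x₀ := hxS
    by_cases hin : Torus.euclidDist (P x) x₀ < ρ'
    · have hVx : ‖(γ x j).2‖ ≤ V := hcap x ⟨hx.1, hx.2.le⟩ hin
      obtain ⟨u, hxu, hstep⟩ := exists_right_flight h x j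
      refine mem_of_superset (Ioo_mem_nhdsGT hxu) fun t ht => ?_
      show ρ - V * t ≤ Torus.euclidDist (P t) x₀
      have htx : 0 ≤ t - x := sub_nonneg.2 ht.1.le
      have h1 : Torus.euclidDist (P x) (P t) ≤ (t - x) * V := by
        rw [Torus.euclidDist_comm]
        exact ((hstep t ⟨ht.1.le, ht.2⟩).1).trans (by gcongr)
      have h2 : Torus.euclidDist (P x) x₀ ≤ Torus.euclidDist (P x) (P t) + Torus.euclidDist (P t) x₀ :=
        torusDist_triangle _ _ _
      nlinarith [h1, h2, hxS']
    · push Not at hin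
      have hlt : ρ - V * x < Torus.euclidDist (P x) x₀ := by
        have : ρ - V * x ≤ ρ := by nlinarith [hx.1]
        linarith
      have hopen : IsOpen {t | ρ - V * t < Torus.euclidDist (P t) x₀} := isOpen_lt (by fun_prop) hgc
      exact mem_nhdsWithin_of_mem_nhds
        (mem_of_superset (hopen.mem_nhds hlt) fun t ht =>
          show ρ - V * t ≤ Torus.euclidDist (P t) x₀ from le_of_lt ht)
  exact fun t ht => key ht

/-- **Registered prelim statement** (stub `stub_anchoredCovering`, kinematics): the guarded
displacement bound and the halo lower bound for one particle of a hard-sphere trajectory on a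
flat torus. -/
theorem anchoredCovering_kinematics : ∀ {d : Type} [Fintype d] {ε : ℝ} {N : ℕ} {γ : ℝ → Config N d (UnitAddTorus d)}, IsHardSphereTrajectory (Torus.geometry d) ε N γ → ∀ (j : Fin N), (∀ (a b V : ℝ), (∀ t ∈ Set.Ico a b, Torus.euclidDist (γ t j).1 (γ a j).1 ≤ V * (t - a) → ‖(γ t j).2‖ ≤ V) → ∀ t ∈ Set.Icc a b, Torus.euclidDist (γ t j).1 (γ a j).1 ≤ V * (t - a)) ∧ (∀ (x₀ : UnitAddTorus d) (L V ρ ρ' : ℝ), 0 ≤ V → ρ < ρ' → (∀ t ∈ Set.Icc 0 L, Torus.euclidDist (γ t j).1 x₀ < ρ' → ‖(γ t j).2‖ ≤ V) → ρ ≤ Torus.euclidDist (γ 0 j).1 x₀ → ∀ t ∈ Set.Icc 0 L, ρ - V * t ≤ Torus.euclidDist (γ t j).1 x₀) :=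
  fun h j => ⟨fun _ _ _ H => disp_le_of_guarded_speed h j H,
    fun x₀ _ _ _ _ hV hρ hcap h0 => sub_le_dist_of_capped_in_halo h j x₀ hV hρ hcap h0⟩

end

end Summit.AtomisticToContinuum.HydrodynamicLimit.Theorems.TrueAnchoredInfection
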